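/-
COR-CM (cells pub-hodgecm / pub-hodgecm2, stage 2 of the Hodge ladder) — TRANSPOSITION SURGE, item (vi) sub-binder S2 / (vi-2)
`supply`: the ASSEMBLY of the pinned as-printed junction at the E-RATIONAL pin (coordinator FINISH-TODAY SWARM
2026-08-21T16:13:55Z (2); pub-hodgecm2 lead NAMING RULING 16:14:26Z (2); own-htheta WORD 16:15:26Z «pin-3 FILES
`CorCM/B01/Transposition/Item6SupplyPinnedAssembly.lean` IMPORTING my `Item6SupplyPinned.lean`»).  Seat prover-pub-hodgecm2-pin-3-0
(pin-3, the integrator; ONE writer of this path).  Theorems only: no definition, no instance, no named fact, nothing asserted, no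
proof holes.  Imported, never edited or restated: own-htheta's `Item6SupplyPinned.lean` (frozen d5b63e6a671a), pin-2's
`Item6PinMatch.lean`, pin-1's `Item6PinReach.lean`, `Item6SupplyReach.lean` (p278665), `Item6HoldsRec.lean` (p279831).
Decl names carry the `_pinnedE` suffix.  FRAMING: HC_CM is NOT proved.
-/
import Summits.HodgeConjecture.CorCM.B01.Transposition.Item6SupplyPinned
import Summits.HodgeConjecture.CorCM.B01.Transposition.Item6PinMatch
import Summits.HodgeConjecture.CorCM.B01.Transposition.Item6PinReach
import Literature.AlgebraicGeometry.Motives.AbelianVarietyProjective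
import HarnessLib

/-!
# Item (vi) S2 from [Liu 2021, Thm. 4.18] AS PRINTED — the assembly at the E-RATIONAL pin `A_μ ⊗_{E,ι₁} ℂ`

own-htheta's junction `Model.faceSupply_of_thm418AsPrinted_pinned` (`Transposition/Item6SupplyPinned.lean`) derives B01-S
`U.FaceSupply` from the cite binder `hLiu : Thm418AsPrinted (D F ι₁ V Φ)` ([Liu2021] Thm. 4.18 EXACTLY AS PRINTED, `FJcycle.tex`
l. 2232–2245; `Literature.NumberTheory.Automorphic.Liu2021.Thm418AsPrinted`, p277833), the printed-elsewhere carriers `hObj`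
(Prop. 4.6 (1), l. 1969) / `hChi` (Def. 4.11, l. 2090) / `hirr` + `hsm` (Def. 4.11, l. 2096 «irreducible admissible»), the CHOICE
`hμ` (`Φ_μ = Φ^{*ι₁}`), and TWO residual binders at a consumer's pin `Aμ F ι₁ V Φ D_μ : AbelianVariety ℂ`: `hCM` (CM side) and
`hReach` (Shimura–Albanese side).  THE PIN OF RECORD (pin-3 INTERFACE v0; pin-1 AGREED pub-hodgecm2/INBOX 16:56:38Z; pin-2 §4/§5):
* a carrier `Aμ₀ F ι₁ V Φ D_μ : AbelianVariety F` = Liu's «`A_μ` is an abelian variety over `E`» ([Liu2021] Def. 4.5 (2),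
  `FJcycle.tex` l. 1944; `E` = the CM field `F`, Liu's `F` = `F⁺`), and
* `Aμ F ι₁ V Φ D_μ := A_μ ⊗_{E,ι₁} ℂ` = the tree's base change `(Aμ₀ F ι₁ V Φ D_μ).baseChange ℂ` along `ι₁`
  (`Literature.AlgebraicGeometry.Motives.AbelianVariety.baseChange`, `Algebra F ℂ := ι₁.toAlgebra`; written inline — no `def`).
At this pin the (U1) half of the object match, «`Hom_E(A_K, A_μ)_ℚ ∋ φ ≠ 0 ⇒ φ_ℂ ≠ 0`», is binder-1's THEOREM
`AbelianVariety.Hom.baseChange_ne_zero` (p288061) inside pin-1's `hReach` derivation, and the CM side is pin-2's reading of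
Def. 4.5 (2) on Liu's OWN field `M_μ` (`IdeleClassGroup.muAlgValueField F μ`, l. 1928) and inclusion `e_μ : K* = ι₁⁻¹(M'_μ) → M_μ`
(Def. 4.3 (2) l. 1919, quantified with its defining property `(e k : ℂ) = ι₁ k`).

§1 `Model.faceSupply_of_thm418AsPrinted_pinnedE_isog` — **THE JUNCTION OF RECORD**: pin-2's `Model.faceSupply_of_thm418AsPrinted_pinned_isog`
  (`Item6PinMatch.lean` §5) AT THE E-RATIONAL PIN.  CM-side binder `hCMisogE` = Def. 4.5 (2) AS PRINTED, i.e. as a RATIONAL CM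
  structure «`i_μ : M_μ → End_E(A_μ)_ℚ`» (l. 1947): `A_μ ⊗_{E,ι₁} ℂ` is ISOGENOUS to a complex abelian variety with multiplication by
  `𝓞_{M_μ}` realising on `H¹_B` the type `Ψ̃_μ = inducedCMType e_μ (reflexCMType ι₁ Φ_μ id)` fixed by the first bullet (l. 1947–1949,
  «the determinant of the action of `i_μ(x)` on the `E`-vector space `Lie_E(A_μ)` equals `η_μ(x)`»; tree reading
  `Liu2021.LiuCMData.cmType_eq_induced_of_det45`).  Shimura side = pin-1's `Model.pinReach_of_componentPinE` (`Item6PinReach.lean` §2)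
  BY NAME, which DISCHARGES own-htheta's `hReach` at the pin from: the carrier `AK F ι₁ V Φ K : AbelianVariety F` (Liu's «`A_K` the
  Albanese variety `Alb_{X_K}` of `X_K`», §4.2 l. 2066, over `E`), the INJECTIVE tie `homE : HomK K D_μ →+ ℚ ⊗_ℤ Hom_F(A_K, A_μ)`
  (item (1) l. 2239: the carrier IS `Hom_E(A_K, A_μ)_ℚ`; (U1) = binder-1's `AbelianVariety.Hom.baseChange_ne_zero`, p288061, a THEOREM)
  and ONE binder `hComp` = (U3ᶜ): below some open compact `Ksm` («sufficiently small» l. 2060, «neat» App. C l. 4599) `A_K ⊗_{E,ι₁} ℂ`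
  is the PRODUCT (limit fan) of the Albanese varieties of finitely many complex surfaces, each ball-uniformised with Gram matrix
  `V.Hm^{ι₁}` and group `ι₁(Γ_c)` for tree levels `Γ_c : Level V` (§4.2 l. 2060–2066; Def. 2.1/2.3 l. 1171–1211; App. C Prop. C.5
  l. 4627–4637 with Def. C.4 / l. 4624; complex points [Deligne 1979 §2.1.2] = tree `Deligne1979.complexPoints_eq_finite_disjoint_sum`).
§1b `Model.faceSupply_of_thm418AsPrinted_pinnedE` — own-htheta's junction BY NAME at the pin, its INTEGRAL `hCM` discharged from
  pin-2's `hCMμE` by `Model.hCM_of_hCMμ_baseChange` (`Item6PinMatch.lean` §4).  `hCMμE` asks for an action of the full ring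
  `𝓞_{M_μ}` on `A_μ ⊗_{E,ι₁} ℂ` ITSELF for EVERY object `D_μ ∈ 𝒜(μ)` — STRONGER THAN PRINT (Def. 4.5 (2) is rational; it holds for
  the objects with `𝓞_{M_μ}`-stable lattice, pin-2 INTEGRALITY NOTE); kept because it is the literal by-name instantiation the
  owner asked for, NOT the display of record.
§2 `Model.hc_cm_of_thm418AsPrinted_pinnedE_isog (U) (hU : U = U_rec) … (hD) : HC_CM` — **THE END DISPLAY OF RECORD**: §1 on the
  universe of record composed, exactly as own-htheta's `Model.hc_cm_of_thm418AsPrinted_pinned`, with item6-p1's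
  `Model.exists_supplyWitness_of_faceSupply` and tr-prover-6's `Model.hc_cm_of_supply_of_dictionary_of_eq` (`Item6HoldsRec.lean`);
  `hD` = items (iii)+(v) at `Θ := Uiso` VERBATIM (:211–226 there; its content includes THETA EXHAUSTION of `U_ψ`, [Liu2021]
  Prop. 4.13 / Rem. 4.14, in no as-printed binder — S2-CLARITY ROW HD).  §2b `Model.hc_cm_of_thm418AsPrinted_pinnedE` — the
  integral variant, = own-htheta's END DISPLAY by name.  [GR91 Prop. 3.1.1] (`GelbartRogawski1991.Prop311AsPrinted`, p277859) does
  not enter this (saturated-set) path.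

BINDER CLASSIFICATION of the display of record §2 (each binder GUARDED to Galois CM `F`, `6 ≤ [F:ℚ]`, `Φ ∋ ι₁`, all `V`; pub-hodgecm2
lead RULING «AS-PRINTED JUNCTION T1»): CARRIERS `D` (Thm. 4.18 data, l. 1878/2053–2074), `Aμ₀` (Def. 4.5 (2) l. 1944); CITE `hLiu`
(Thm. 4.18 l. 2232–2245, EXACT); `hObj` (Prop. 4.6 (1) l. 1969), `hChi` (Def. 4.11 l. 2090), `hirr`/`hsm` (Def. 4.11 l. 2096) —
REINDEX-ONLY / DISCHARGEABLE-BY-KNOWN-RESULT (S2-CLARITY Table C rows C2–C4); `hμ` — a CHOICE (row C5); `hCMisogE` — READING of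
Def. 4.5 (1)–(2) l. 1939–1951 + Def. 4.3 (2) l. 1919 on `H¹_B(A_μ ⊗_{E,ι₁} ℂ)` up to isogeny (row C6: DISCHARGEABLE-BY-KNOWN-RESULT
modulo the carrier pin, which is now MADE); CARRIER `AK` (§4.2 l. 2066) with the tie `homE`/`hE` (item (1) l. 2239); `hComp` — READING
of §4.2 l. 2060–2076 + App. C Prop. C.5 l. 4627–4637 + Def. 2.1/2.3 l. 1171–1211 with the non-Liu input (h2) complex points [Deligne
1979 §2.1.2] = tree `Deligne1979.complexPoints_eq_finite_disjoint_sum`; (h3) model uniqueness / GAGA and (h4) Albanese transport are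
KERNEL inside pin-1's proof (`UnitaryBallModelUnique.exists_iso_of_eq`, `Jacobian.exists_hom_ne_zero_of_iso`) (row C7 = the S2-CRUX
(M-Sh), now ONE named binder); `hD` — outside S2 (ROW HD).  NO printed hypothesis of [Liu 4.18] / [GR91 3.1.1] is undischarged at a
general face; what is not inhabited is the PINNING RECORD (`hCMisogE`, `hComp`) — identifications of Liu's objects (`A_μ ⊗_{E,ι₁} ℂ`,
`A_K ⊗_{E,ι₁} ℂ = Alb(X_K ⊗ ℂ)`) with tree objects.

STRENGTH (kernel): every family here ⟹ B01-S (`U.FaceSupply`); conversely own-htheta's certificate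
(`Item6SupplyPinnedCertificate.lean`, `Model.exists_pin_iff_faceSupply`) shows «SOME complex pin satisfies (hCM, hReach)» ⟸ B01-S,
but at the E-RATIONAL pin NO `↔` is available or claimed: with `HomK` meaning `ℚ ⊗ Hom_F(A_K, A_μ)` the Liu-side binders force a
non-zero `F`-rational homomorphism between `F`-MODELS (htheta-x2 g4 EPIN-T1 (E2) `X2EPIN.fmodels_of_pinE_family`; x1 PIN-TYPED
§3d/§4b) — canonical-model content no complex reach witness supplies; the TYPE of such data is inhabited (x2 g4 (E1), empty pin).
So: ⟹ B01-S, classification changed (printed readings + carriers instead of one object match), kernel content toward S2 NOT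
increased.  HC_CM is NOT proved; `hCMisogE` / `hCMμE` / `hComp` / `hD` are NOT inhabited here.

NOT claimed: that Liu's objects are CONSTRUCTED (`D`, `Aμ₀`, `AK` are the consumer's carriers; intended instantiation = liuC-typer-4's
`AppendixC.Glue`, `D := Thm418Data.ofAppendixC C R`, `HomK K D_μ := ℚ ⊗[ℤ] (A_K ⟶ A_μ)`, `homE := id`); that the citation is EXACT
at face generality (red-team (A)).  References: Y. Liu, arXiv:2102.11518 = Camb. J. Math. 9 (2021), `FJcycle.tex` md5 6db49a74122d
(lines as quoted); G. Shimura, *Abelian Varieties with Complex Multiplication and Modular Functions* (1998) §5.2, §6.2 Thm. 3, §8.3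
Prop. 28; P. Deligne, *Variétés de Shimura*, PSPM 33.2 (1979) §2.1.2; U. Görtz–T. Wedhorn, *Algebraic Geometry I* (2020) Thm. 14.72 (1).
-/

noncomputable section

open scoped TensorProduct InnerProductSpace

namespace Summit.HodgeConjecture.CorCM.Model
open CategoryTheory CategoryTheory.Limits AlgebraicGeometry NumberField
open Literature.AlgebraicGeometry.Motives
open Literature.AlgebraicGeometry.ShimuraVarieties
open Literature.AlgebraicGeometry.Motives.HodgeStructure (conj)
open Literature.AlgebraicGeometry.HodgeTheory
open Literature.AlgebraicGeometry.ComplexMultiplication (IsCMTypeRealisation)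
open Literature.NumberTheory.ComplexMultiplication
open Literature.NumberTheory.Automorphic
open Literature.NumberTheory.Automorphic.IdeleClassGroup
open Literature.NumberTheory.Automorphic.PicardCM
open Literature.NumberTheory.Automorphic.Liu2021

/-! ## §1  B01-S from [Liu 2021, Thm. 4.18] AS PRINTED at the E-rational pin — THE JUNCTION OF RECORD (CM side up to isogeny) -/
section Data

/-- **B01-S from [Liu 2021, Thm. 4.18] AS PRINTED at the E-RATIONAL pin, CM side as printed (rational, i.e. up to isogeny)**
(`U = picardCMUniverse hHD hI h₁ h₃`).  Carriers: the datum family `D F ι₁ V Φ : Thm418Data F⁺ F` and Liu's `A_μ` OVER `E`,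
`Aμ₀ F ι₁ V Φ D_μ : AbelianVariety F` (Def. 4.5 (2) l. 1944); the pin is `A_μ ⊗_{E,ι₁} ℂ := (Aμ₀ …).baseChange ℂ` along `ι₁`.
Binders, each only for Galois CM `F`, `6 ≤ [F:ℚ]`, `Φ ∋ ι₁`, every `V`: `hLiu` THE CITE [Liu2021] Thm. 4.18 exactly as printed
(l. 2232–2245); `hObj` `𝒜(μ) ≠ ∅` (Prop. 4.6 (1) l. 1969); `hChi` a character of `E¹\(𝔸_E^∞)¹` (Def. 4.11 l. 2090); `hirr`/`hsm`
«irreducible admissible» (Def. 4.11 l. 2096); `hμ` the CHOICE `Φ_μ = Φ^{*ι₁}`;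
* `hCMisogE` (pin-2's `hCMisog` at the pin) — for Liu's `M_μ = muAlgValueField F μ` (l. 1928) and THE inclusion `e_μ : K* → M_μ`
  (Def. 4.3 (2) l. 1919): `A_μ ⊗_{E,ι₁} ℂ` is isogenous (`g`, `AbelianVariety.IsIsogeny g`) to a complex abelian variety `B` with
  multiplication by `𝓞_{M_μ}` realising on `H¹_B` the type `inducedCMType e_μ (reflexCMType ι₁ Φ_μ id)` — [Liu2021] Def. 4.5 (2)
  l. 1944–1951 («`i_μ : M_μ → End_E(A_μ)_ℚ` is a CM structure such that — for every `x ∈ M_μ`, the determinant of the action of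
  `i_μ(x)` on the `E`-vector space `Lie_E(A_μ)` equals `η_μ(x)`») with (1) l. 1939–1942 and Def. 4.3 (2) l. 1919, read on `H¹_B`
  up to isogeny (Shimura 1998 §5.2: an `𝓞`-stable lattice exists in the isogeny class);
* Shimura side (pin-1): carrier `AK F ι₁ V Φ K : AbelianVariety F` («`A_K` the Albanese variety `Alb_{X_K}` of `X_K`», §4.2 l. 2066),
  INJECTIVE tie `homE K D_μ : HomK K D_μ →+ ℚ ⊗_ℤ Hom_F(A_K, A_μ)` (item (1) l. 2239, «`Hom_E(A_K, A_μ)_ℚ`»), and `hComp` — below SOME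
  open compact `Ksm` («sufficiently small», §4.2 l. 2060; «neat», App. C l. 4599) `A_K ⊗_{E,ι₁} ℂ` is a PRODUCT (limit fan) of the
  Albanese varieties (tree `Jacobian`) of finitely many complex surfaces `X c`, each with a ball uniformisation of Gram matrix
  `V.Hm^{ι₁}` and group `ι₁(Γ_c)`, `Γ c : Level V` ([Liu2021] §4.2 l. 2060–2066 «`X_K := \tilde Sh(𝕍)_K`», «`A_K := Alb_{X_K}`»;
  Def. 2.1/2.3 l. 1171–1211; App. C Prop. C.5 l. 4627–4637; complex points [Deligne 1979 §2.1.2]).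
KERNEL: pin-2's `Model.faceSupply_of_thm418AsPrinted_pinned_isog` at `Aμ := A_μ ⊗_{E,ι₁} ℂ` with `hReach :=` pin-1's
`Model.pinReach_of_componentPinE`, nothing else.  HC_CM is NOT proved; `hCMisogE`, `hComp` are not inhabited here. [cite: Liu2021, Thm. 4.18 (FJcycle.tex l. 2232–2245) and Def. 4.5 (2) (l. 1944–1951)] -/
theorem faceSupply_of_thm418AsPrinted_pinnedE_isog
    (hHD : exists_isReal_hodgeModel) (hI : hodgePQ_independent_of_hodgeModel)
    (h₁ : BallQuotientUniformised) (h₃ : CMAbelianVarietyRealised)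
    (D : ∀ (F : CMField) (ι₁ : F →+* ℂ) (_ : HermSpace3 F ι₁) (_ : CMType F), Thm418Data (maximalRealSubfield F) F)
    (Aμ₀ : ∀ (F : CMField) (ι₁ : F →+* ℂ) (V : HermSpace3 F ι₁) (Φ : CMType F), (D F ι₁ V Φ).Obj → AbelianVariety F)
    (AK : ∀ (F : CMField) (ι₁ : F →+* ℂ) (V : HermSpace3 F ι₁) (Φ : CMType F), Subgroup (D F ι₁ V Φ).G → AbelianVariety F)
    (homE : ∀ (F : CMField) (ι₁ : F →+* ℂ) (V : HermSpace3 F ι₁) (Φ : CMType F) (K : Subgroup (D F ι₁ V Φ).G)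
      (Dμ : (D F ι₁ V Φ).Obj), (D F ι₁ V Φ).HomK K Dμ →+ ℚ ⊗[ℤ] (AK F ι₁ V Φ K ⟶ Aμ₀ F ι₁ V Φ Dμ))
    (hE : ∀ (F : CMField) (ι₁ : F →+* ℂ) (V : HermSpace3 F ι₁) (Φ : CMType F) (K : Subgroup (D F ι₁ V Φ).G)
      (Dμ : (D F ι₁ V Φ).Obj), Function.Injective (homE F ι₁ V Φ K Dμ))
    (hLiu : ∀ (F : CMField), IsGalois ℚ F → 6 ≤ Module.finrank ℚ F → ∀ (Φ : CMType F) (ι₁ : F →+* ℂ), ι₁ ∈ Φ.1 →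
      ∀ V : HermSpace3 F ι₁, Thm418AsPrinted (D F ι₁ V Φ))
    (hObj : ∀ (F : CMField), IsGalois ℚ F → 6 ≤ Module.finrank ℚ F → ∀ (Φ : CMType F) (ι₁ : F →+* ℂ), ι₁ ∈ Φ.1 →
      ∀ V : HermSpace3 F ι₁, Nonempty (D F ι₁ V Φ).Obj)
    (hChi : ∀ (F : CMField), IsGalois ℚ F → 6 ≤ Module.finrank ℚ F → ∀ (Φ : CMType F) (ι₁ : F →+* ℂ), ι₁ ∈ Φ.1 →
      ∀ V : HermSpace3 F ι₁, Nonempty (D F ι₁ V Φ).Chi)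
    (hirr : ∀ (F : CMField), IsGalois ℚ F → 6 ≤ Module.finrank ℚ F → ∀ (Φ : CMType F) (ι₁ : F →+* ℂ), ι₁ ∈ Φ.1 →
      ∀ (V : HermSpace3 F ι₁) (i : (D F ι₁ V Φ).AdmIndex), ((D F ι₁ V Φ).rhoAt i).IsIrreducible)
    (hsm : ∀ (F : CMField), IsGalois ℚ F → 6 ≤ Module.finrank ℚ F → ∀ (Φ : CMType F) (ι₁ : F →+* ℂ), ι₁ ∈ Φ.1 →
      ∀ (V : HermSpace3 F ι₁) (i : (D F ι₁ V Φ).AdmIndex) (v : (D F ι₁ V Φ).omegaAt i),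
        ∃ S : Subgroup (D F ι₁ V Φ).G, IsOpen (S : Set (D F ι₁ V Φ).G) ∧ ∀ k ∈ S, (D F ι₁ V Φ).rhoAt i k v = v)
    (hμ : ∀ (F : CMField), IsGalois ℚ F → 6 ≤ Module.finrank ℚ F → ∀ (Φ : CMType F) (ι₁ : F →+* ℂ), ι₁ ∈ Φ.1 →
      ∀ (V : HermSpace3 F ι₁) (g : F ≃ₐ[ℚ] F),
        ι₁.comp (g : F →+* F) ∈ (D F ι₁ V Φ).cmType.1 ↔ ι₁.comp (g.symm : F →+* F) ∈ Φ.1)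
    (hCMisogE : ∀ (F : CMField) [IsGalois ℚ F], 6 ≤ Module.finrank ℚ F → ∀ (Φ : CMType F) (ι₁ : F →+* ℂ), ι₁ ∈ Φ.1 →
      ∀ (V : HermSpace3 F ι₁) (Dμ : (D F ι₁ V Φ).Obj),
        haveI := (D F ι₁ V Φ).isConjugateSymplectic.numberField_muAlgValueField
        ∀ e : reflexField ℚ F (algValuedIn ι₁ (D F ι₁ V Φ).cmType.1) →+* muAlgValueField F (D F ι₁ V Φ).μ,
          (∀ k : reflexField ℚ F (algValuedIn ι₁ (D F ι₁ V Φ).cmType.1),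
            ((e k : muAlgValueField F (D F ι₁ V Φ).μ) : ℂ) = ι₁ k) →
          ∃ (B : AbelianVariety ℂ) (g : (letI := ι₁.toAlgebra; (Aμ₀ F ι₁ V Φ Dμ).baseChange ℂ) ⟶ B), AbelianVariety.IsIsogeny g ∧
            ∃ (ιB : 𝓞 (muAlgValueField F (D F ι₁ V Φ).μ) →+* End B)
              (θB : muAlgValueField F (D F ι₁ V Φ).μ →+* Module.End ℂ (complexBetti B.X 1)),
              IsCMTypeRealisation (inducedCMType e (reflexCMType ι₁ (D F ι₁ V Φ).cmType (AlgHom.id ℚ F))) B ιB θB)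
    (hComp : ∀ (F : CMField), IsGalois ℚ F → 6 ≤ Module.finrank ℚ F → ∀ (Φ : CMType F) (ι₁ : F →+* ℂ), ι₁ ∈ Φ.1 →
      ∀ V : HermSpace3 F ι₁, ∃ Ksm : Subgroup (D F ι₁ V Φ).G, IsOpenCompact Ksm ∧
        ∀ K : Subgroup (D F ι₁ V Φ).G, IsOpenCompact K → K ≤ Ksm →
          ∃ (C : Type) (_ : Fintype C) (X : C → SchemeOver ℂ) (B : ∀ c, UnitaryBallUniformisationDatum 2 (X c))
            (Γ : C → Level V) (𝒥 : ∀ c, Jacobian (X c))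
            (π : ∀ c, (letI := ι₁.toAlgebra; (AK F ι₁ V Φ K).baseChange ℂ) ⟶ (𝒥 c).J),
            (∀ c, (B c).Hℂ = V.Hm.map ι₁) ∧
            (∀ c, (B c).Γ.map (Matrix.GeneralLinearGroup.map (B c).τ₁) =
              (Γ c).Γ.map (Matrix.GeneralLinearGroup.map ι₁)) ∧
            Nonempty (IsLimit (Fan.mk (letI := ι₁.toAlgebra; (AK F ι₁ V Φ K).baseChange ℂ) π))) :
    (picardCMUniverse hHD hI h₁ h₃).FaceSupply :=
  faceSupply_of_thm418AsPrinted_pinned_isog hHD hI h₁ h₃ D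
    (fun F ι₁ V Φ Dμ => letI := ι₁.toAlgebra; (Aμ₀ F ι₁ V Φ Dμ).baseChange ℂ)
    hLiu hObj hChi hirr hsm hμ (fun F _ h6 Φ ι₁ hι V Dμ => hCMisogE F h6 Φ ι₁ hι V Dμ)
    (pinReach_of_componentPinE h₁ h₃ D AK Aμ₀ homE hE hComp)

/-! ## §1b  The same through own-htheta's junction BY NAME (integral CM side — stronger than print, see module docstring) -/
/-- **B01-S at the E-rational pin through own-htheta's `Model.faceSupply_of_thm418AsPrinted_pinned` BY NAME**, its integral CM-side
binder `hCM` (an action of a full ring of integers `𝓞_M` on the pin itself) discharged from pin-2's `M_μ`-sharpened family `hCMμE`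
by `Model.hCM_of_hCMμ_baseChange` (`Item6PinMatch.lean` §4): `hCMμE` — for Liu's `M_μ = muAlgValueField F μ` (l. 1928) and THE
inclusion `e_μ : K* → M_μ` (Def. 4.3 (2) l. 1919), `A_μ ⊗_{E,ι₁} ℂ` carries an action of `𝓞_{M_μ}` (Liu's `i_μ`, Def. 4.5 (2)
l. 1947, base-changed) realising on `H¹_B` the type `inducedCMType e_μ (reflexCMType ι₁ Φ_μ id)` (Def. 4.5 (2) first bullet
l. 1947–1949).  INTEGRALITY: demanded for EVERY `D_μ ∈ 𝒜(μ)` this is STRONGER than the printed RATIONAL structure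
«`M_μ → End_E(A_μ)_ℚ`» (true for the objects with `𝓞_{M_μ}`-stable lattice); the as-printed form is §1's `hCMisogE`.  All other
carriers and binders as in §1.  HC_CM is NOT proved; `hCMμE`, `hComp` are not inhabited here.
[cite: Liu2021, Thm. 4.18 (FJcycle.tex l. 2232–2245) and Def. 4.5 (2) (l. 1944–1951)] -/
theorem faceSupply_of_thm418AsPrinted_pinnedE
    (hHD : exists_isReal_hodgeModel) (hI : hodgePQ_independent_of_hodgeModel)
    (h₁ : BallQuotientUniformised) (h₃ : CMAbelianVarietyRealised)
    (D : ∀ (F : CMField) (ι₁ : F →+* ℂ) (_ : HermSpace3 F ι₁) (_ : CMType F), Thm418Data (maximalRealSubfield F) F)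
    (Aμ₀ : ∀ (F : CMField) (ι₁ : F →+* ℂ) (V : HermSpace3 F ι₁) (Φ : CMType F), (D F ι₁ V Φ).Obj → AbelianVariety F)
    (AK : ∀ (F : CMField) (ι₁ : F →+* ℂ) (V : HermSpace3 F ι₁) (Φ : CMType F), Subgroup (D F ι₁ V Φ).G → AbelianVariety F)
    (homE : ∀ (F : CMField) (ι₁ : F →+* ℂ) (V : HermSpace3 F ι₁) (Φ : CMType F) (K : Subgroup (D F ι₁ V Φ).G)
      (Dμ : (D F ι₁ V Φ).Obj), (D F ι₁ V Φ).HomK K Dμ →+ ℚ ⊗[ℤ] (AK F ι₁ V Φ K ⟶ Aμ₀ F ι₁ V Φ Dμ))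
    (hE : ∀ (F : CMField) (ι₁ : F →+* ℂ) (V : HermSpace3 F ι₁) (Φ : CMType F) (K : Subgroup (D F ι₁ V Φ).G)
      (Dμ : (D F ι₁ V Φ).Obj), Function.Injective (homE F ι₁ V Φ K Dμ))
    (hLiu : ∀ (F : CMField), IsGalois ℚ F → 6 ≤ Module.finrank ℚ F → ∀ (Φ : CMType F) (ι₁ : F →+* ℂ), ι₁ ∈ Φ.1 →
      ∀ V : HermSpace3 F ι₁, Thm418AsPrinted (D F ι₁ V Φ))
    (hObj : ∀ (F : CMField), IsGalois ℚ F → 6 ≤ Module.finrank ℚ F → ∀ (Φ : CMType F) (ι₁ : F →+* ℂ), ι₁ ∈ Φ.1 →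
      ∀ V : HermSpace3 F ι₁, Nonempty (D F ι₁ V Φ).Obj)
    (hChi : ∀ (F : CMField), IsGalois ℚ F → 6 ≤ Module.finrank ℚ F → ∀ (Φ : CMType F) (ι₁ : F →+* ℂ), ι₁ ∈ Φ.1 →
      ∀ V : HermSpace3 F ι₁, Nonempty (D F ι₁ V Φ).Chi)
    (hirr : ∀ (F : CMField), IsGalois ℚ F → 6 ≤ Module.finrank ℚ F → ∀ (Φ : CMType F) (ι₁ : F →+* ℂ), ι₁ ∈ Φ.1 →
      ∀ (V : HermSpace3 F ι₁) (i : (D F ι₁ V Φ).AdmIndex), ((D F ι₁ V Φ).rhoAt i).IsIrreducible)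
    (hsm : ∀ (F : CMField), IsGalois ℚ F → 6 ≤ Module.finrank ℚ F → ∀ (Φ : CMType F) (ι₁ : F →+* ℂ), ι₁ ∈ Φ.1 →
      ∀ (V : HermSpace3 F ι₁) (i : (D F ι₁ V Φ).AdmIndex) (v : (D F ι₁ V Φ).omegaAt i),
        ∃ S : Subgroup (D F ι₁ V Φ).G, IsOpen (S : Set (D F ι₁ V Φ).G) ∧ ∀ k ∈ S, (D F ι₁ V Φ).rhoAt i k v = v)
    (hμ : ∀ (F : CMField), IsGalois ℚ F → 6 ≤ Module.finrank ℚ F → ∀ (Φ : CMType F) (ι₁ : F →+* ℂ), ι₁ ∈ Φ.1 →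
      ∀ (V : HermSpace3 F ι₁) (g : F ≃ₐ[ℚ] F),
        ι₁.comp (g : F →+* F) ∈ (D F ι₁ V Φ).cmType.1 ↔ ι₁.comp (g.symm : F →+* F) ∈ Φ.1)
    (hCMμE : ∀ (F : CMField) [IsGalois ℚ F], 6 ≤ Module.finrank ℚ F → ∀ (Φ : CMType F) (ι₁ : F →+* ℂ), ι₁ ∈ Φ.1 →
      ∀ (V : HermSpace3 F ι₁) (Dμ : (D F ι₁ V Φ).Obj),
        haveI := (D F ι₁ V Φ).isConjugateSymplectic.numberField_muAlgValueField
        ∀ e : reflexField ℚ F (algValuedIn ι₁ (D F ι₁ V Φ).cmType.1) →+* muAlgValueField F (D F ι₁ V Φ).μ,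
          (∀ k : reflexField ℚ F (algValuedIn ι₁ (D F ι₁ V Φ).cmType.1),
            ((e k : muAlgValueField F (D F ι₁ V Φ).μ) : ℂ) = ι₁ k) →
          ∃ (ιB : 𝓞 (muAlgValueField F (D F ι₁ V Φ).μ) →+*
                End (letI := ι₁.toAlgebra; (Aμ₀ F ι₁ V Φ Dμ).baseChange ℂ))
            (θB : muAlgValueField F (D F ι₁ V Φ).μ →+*
                Module.End ℂ (complexBetti (letI := ι₁.toAlgebra; (Aμ₀ F ι₁ V Φ Dμ).baseChange ℂ).X 1)),
            IsCMTypeRealisation (inducedCMType e (reflexCMType ι₁ (D F ι₁ V Φ).cmType (AlgHom.id ℚ F)))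
              (letI := ι₁.toAlgebra; (Aμ₀ F ι₁ V Φ Dμ).baseChange ℂ) ιB θB)
    (hComp : ∀ (F : CMField), IsGalois ℚ F → 6 ≤ Module.finrank ℚ F → ∀ (Φ : CMType F) (ι₁ : F →+* ℂ), ι₁ ∈ Φ.1 →
      ∀ V : HermSpace3 F ι₁, ∃ Ksm : Subgroup (D F ι₁ V Φ).G, IsOpenCompact Ksm ∧
        ∀ K : Subgroup (D F ι₁ V Φ).G, IsOpenCompact K → K ≤ Ksm →
          ∃ (C : Type) (_ : Fintype C) (X : C → SchemeOver ℂ) (B : ∀ c, UnitaryBallUniformisationDatum 2 (X c))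
            (Γ : C → Level V) (𝒥 : ∀ c, Jacobian (X c))
            (π : ∀ c, (letI := ι₁.toAlgebra; (AK F ι₁ V Φ K).baseChange ℂ) ⟶ (𝒥 c).J),
            (∀ c, (B c).Hℂ = V.Hm.map ι₁) ∧
            (∀ c, (B c).Γ.map (Matrix.GeneralLinearGroup.map (B c).τ₁) =
              (Γ c).Γ.map (Matrix.GeneralLinearGroup.map ι₁)) ∧
            Nonempty (IsLimit (Fan.mk (letI := ι₁.toAlgebra; (AK F ι₁ V Φ K).baseChange ℂ) π))) :
    (picardCMUniverse hHD hI h₁ h₃).FaceSupply :=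
  faceSupply_of_thm418AsPrinted_pinned hHD hI h₁ h₃ D
    (fun F ι₁ V Φ Dμ => letI := ι₁.toAlgebra; (Aμ₀ F ι₁ V Φ Dμ).baseChange ℂ)
    hLiu hObj hChi hirr hsm hμ (hCM_of_hCMμ_baseChange D Aμ₀ hCMμE)
    (pinReach_of_componentPinE h₁ h₃ D AK Aμ₀ homE hE hComp)

end Data

/-! ## §2  THE END DISPLAY on the universe of record, at the E-rational pin -/
section EndState

/-- **END DISPLAY OF RECORD at the E-rational pin** (`hU : U = U_rec`, instantiate with `rfl`): `HC_CM` from [Liu 2021, Thm. 4.18]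
AS PRINTED (`hLiu`), its printed-elsewhere carriers (`hObj` Prop. 4.6 (1) l. 1969; `hChi` Def. 4.11 l. 2090; `hirr`/`hsm` Def. 4.11
l. 2096 «irreducible admissible»), the CHOICE `hμ` (`Φ_μ = Φ^{*ι₁}`), Liu's `A_μ` OVER `E` (`Aμ₀`, Def. 4.5 (2) l. 1944) with — on the
pin `A_μ ⊗_{E,ι₁} ℂ` — `hCMisogE` (pin-2: Def. 4.5 (1)–(2) l. 1939–1951 + Def. 4.3 (2) l. 1919, up to isogeny, AS PRINTED) and
pin-1's `AK`/`homE`/`hE`/`hComp` (§4.2 l. 2060–2076, item (1) l. 2239, App. C Prop. C.5 l. 4627–4637 read with (h2)), every one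
GUARDED to Galois CM `F`,
`6 ≤ [F:ℚ]`, `Φ ∋ ι₁`, and the `L²` dictionary with isolation `hD` (items (iii)+(v) at `Θ := Uiso`, verbatim from
`Model.hc_cm_of_supply_of_dictionary_of_eq`, `Item6HoldsRec.lean`:211–226; its content includes THETA EXHAUSTION of `U_ψ`, [Liu2021]
Prop. 4.13 / Rem. 4.14, in no as-printed binder).  Composition BY NAME: `hc_cm_of_supply_of_dictionary_of_eq _ rfl` ∘
`exists_supplyWitness_of_faceSupply` ∘ §1.  [GR91 Prop. 3.1.1] does not enter.  HC_CM is NOT proved: `hCMisogE`, `hComp`, `hD` are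
not inhabited here. [cite: Liu2021, Thm. 4.18 (FJcycle.tex l. 2232–2245) and Def. 4.5 (2) (l. 1944–1951)] -/
theorem hc_cm_of_thm418AsPrinted_pinnedE_isog (U : Universe)
    (hU : U = picardCMUniverse exists_isReal_hodgeModel_holds hodgePQ_independent_of_hodgeModel_holds
      BallQuotient.ballQuotientUniformised_holds cmAbelianVarietyRealised_holds)
    (D : ∀ (F : CMField) (ι₁ : F →+* ℂ) (_ : HermSpace3 F ι₁) (_ : CMType F), Thm418Data (maximalRealSubfield F) F)
    (Aμ₀ : ∀ (F : CMField) (ι₁ : F →+* ℂ) (V : HermSpace3 F ι₁) (Φ : CMType F), (D F ι₁ V Φ).Obj → AbelianVariety F)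
    (AK : ∀ (F : CMField) (ι₁ : F →+* ℂ) (V : HermSpace3 F ι₁) (Φ : CMType F), Subgroup (D F ι₁ V Φ).G → AbelianVariety F)
    (homE : ∀ (F : CMField) (ι₁ : F →+* ℂ) (V : HermSpace3 F ι₁) (Φ : CMType F) (K : Subgroup (D F ι₁ V Φ).G)
      (Dμ : (D F ι₁ V Φ).Obj), (D F ι₁ V Φ).HomK K Dμ →+ ℚ ⊗[ℤ] (AK F ι₁ V Φ K ⟶ Aμ₀ F ι₁ V Φ Dμ))
    (hE : ∀ (F : CMField) (ι₁ : F →+* ℂ) (V : HermSpace3 F ι₁) (Φ : CMType F) (K : Subgroup (D F ι₁ V Φ).G)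
      (Dμ : (D F ι₁ V Φ).Obj), Function.Injective (homE F ι₁ V Φ K Dμ))
    (hLiu : ∀ (F : CMField), IsGalois ℚ F → 6 ≤ Module.finrank ℚ F → ∀ (Φ : CMType F) (ι₁ : F →+* ℂ), ι₁ ∈ Φ.1 →
      ∀ V : HermSpace3 F ι₁, Thm418AsPrinted (D F ι₁ V Φ))
    (hObj : ∀ (F : CMField), IsGalois ℚ F → 6 ≤ Module.finrank ℚ F → ∀ (Φ : CMType F) (ι₁ : F →+* ℂ), ι₁ ∈ Φ.1 →
      ∀ V : HermSpace3 F ι₁, Nonempty (D F ι₁ V Φ).Obj)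
    (hChi : ∀ (F : CMField), IsGalois ℚ F → 6 ≤ Module.finrank ℚ F → ∀ (Φ : CMType F) (ι₁ : F →+* ℂ), ι₁ ∈ Φ.1 →
      ∀ V : HermSpace3 F ι₁, Nonempty (D F ι₁ V Φ).Chi)
    (hirr : ∀ (F : CMField), IsGalois ℚ F → 6 ≤ Module.finrank ℚ F → ∀ (Φ : CMType F) (ι₁ : F →+* ℂ), ι₁ ∈ Φ.1 →
      ∀ (V : HermSpace3 F ι₁) (i : (D F ι₁ V Φ).AdmIndex), ((D F ι₁ V Φ).rhoAt i).IsIrreducible)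
    (hsm : ∀ (F : CMField), IsGalois ℚ F → 6 ≤ Module.finrank ℚ F → ∀ (Φ : CMType F) (ι₁ : F →+* ℂ), ι₁ ∈ Φ.1 →
      ∀ (V : HermSpace3 F ι₁) (i : (D F ι₁ V Φ).AdmIndex) (v : (D F ι₁ V Φ).omegaAt i),
        ∃ S : Subgroup (D F ι₁ V Φ).G, IsOpen (S : Set (D F ι₁ V Φ).G) ∧ ∀ k ∈ S, (D F ι₁ V Φ).rhoAt i k v = v)
    (hμ : ∀ (F : CMField), IsGalois ℚ F → 6 ≤ Module.finrank ℚ F → ∀ (Φ : CMType F) (ι₁ : F →+* ℂ), ι₁ ∈ Φ.1 →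
      ∀ (V : HermSpace3 F ι₁) (g : F ≃ₐ[ℚ] F),
        ι₁.comp (g : F →+* F) ∈ (D F ι₁ V Φ).cmType.1 ↔ ι₁.comp (g.symm : F →+* F) ∈ Φ.1)
    (hCMisogE : ∀ (F : CMField) [IsGalois ℚ F], 6 ≤ Module.finrank ℚ F → ∀ (Φ : CMType F) (ι₁ : F →+* ℂ), ι₁ ∈ Φ.1 →
      ∀ (V : HermSpace3 F ι₁) (Dμ : (D F ι₁ V Φ).Obj),
        haveI := (D F ι₁ V Φ).isConjugateSymplectic.numberField_muAlgValueField
        ∀ e : reflexField ℚ F (algValuedIn ι₁ (D F ι₁ V Φ).cmType.1) →+* muAlgValueField F (D F ι₁ V Φ).μ,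
          (∀ k : reflexField ℚ F (algValuedIn ι₁ (D F ι₁ V Φ).cmType.1),
            ((e k : muAlgValueField F (D F ι₁ V Φ).μ) : ℂ) = ι₁ k) →
          ∃ (B : AbelianVariety ℂ) (g : (letI := ι₁.toAlgebra; (Aμ₀ F ι₁ V Φ Dμ).baseChange ℂ) ⟶ B), AbelianVariety.IsIsogeny g ∧
            ∃ (ιB : 𝓞 (muAlgValueField F (D F ι₁ V Φ).μ) →+* End B)
              (θB : muAlgValueField F (D F ι₁ V Φ).μ →+* Module.End ℂ (complexBetti B.X 1)),
              IsCMTypeRealisation (inducedCMType e (reflexCMType ι₁ (D F ι₁ V Φ).cmType (AlgHom.id ℚ F))) B ιB θB)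
    (hComp : ∀ (F : CMField), IsGalois ℚ F → 6 ≤ Module.finrank ℚ F → ∀ (Φ : CMType F) (ι₁ : F →+* ℂ), ι₁ ∈ Φ.1 →
      ∀ V : HermSpace3 F ι₁, ∃ Ksm : Subgroup (D F ι₁ V Φ).G, IsOpenCompact Ksm ∧
        ∀ K : Subgroup (D F ι₁ V Φ).G, IsOpenCompact K → K ≤ Ksm →
          ∃ (C : Type) (_ : Fintype C) (X : C → SchemeOver ℂ) (B : ∀ c, UnitaryBallUniformisationDatum 2 (X c))
            (Γ : C → Level V) (𝒥 : ∀ c, Jacobian (X c))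
            (π : ∀ c, (letI := ι₁.toAlgebra; (AK F ι₁ V Φ K).baseChange ℂ) ⟶ (𝒥 c).J),
            (∀ c, (B c).Hℂ = V.Hm.map ι₁) ∧
            (∀ c, (B c).Γ.map (Matrix.GeneralLinearGroup.map (B c).τ₁) =
              (Γ c).Γ.map (Matrix.GeneralLinearGroup.map ι₁)) ∧
            Nonempty (IsLimit (Fan.mk (letI := ι₁.toAlgebra; (AK F ι₁ V Φ K).baseChange ℂ) π)))
    (hD : ∀ (F : CMField), IsGalois ℚ F → 6 ≤ Module.finrank ℚ F → ∀ (f : Face F) (ι₁ : F →+* ℂ), f.Admissible ι₁ →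
      ∀ V : HermSpace3 F ι₁,
        ∃ (HG : Type) (_ : NormedAddCommGroup HG) (_ : InnerProductSpace ℂ HG)
          (emb : ∀ Γ : Level V, U.CohC (U.pms F ι₁ V Γ) 2 →ₗ[ℂ] HG)
          (cover : ∀ (Γ Γ' : Level V), Γ' ≤ Γ → U.Mor (U.pms F ι₁ V Γ') (U.pms F ι₁ V Γ)),
          (∀ (Γ : Level V) (ω₁ ω₂ : U.CohC (U.pms F ι₁ V Γ) 1), ω₁ ∈ U.Uiso Γ F (f.psi 0) ι₁ → ω₂ ∈ U.Uiso Γ F (f.psi 1) ι₁ →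
            emb Γ (U.cup2C (U.pms F ι₁ V Γ) 1 ω₁ ω₂) ∈ (Submodule.span ℂ
              {x : HG | ∃ (Γ' : Level V), ∃ ω₃ ∈ U.Uiso Γ' F (f.psi 2) ι₁, ∃ ω₄ ∈ U.Uiso Γ' F (f.psi 3) ι₁,
                x = emb Γ' (U.cup2C (U.pms F ι₁ V Γ') 1 ω₃ ω₄)}).topologicalClosure) ∧
          (∀ (Γ Γ' : Level V) (hle : Γ' ≤ Γ) (x : U.CohC (U.pms F ι₁ V Γ) 2),
            emb Γ' (U.pullC (cover Γ Γ' hle) 2 x) = emb Γ x) ∧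
          (∀ Γ : Level V, ∃ c : ℂ, c ≠ 0 ∧ ∀ x y : U.CohC (U.pms F ι₁ V Γ) 2,
            x ∈ (U.hodge (U.pms F ι₁ V Γ) 2).F 2 → y ∈ (U.hodge (U.pms F ι₁ V Γ) 2).F 2 →
              ⟪emb Γ y, emb Γ x⟫_ℂ = c * U.trC (U.pms F ι₁ V Γ) 4 (U.cup2C (U.pms F ι₁ V Γ) 2 x (conj y)))) :
    HC_CM := by
  subst hU
  exact hc_cm_of_supply_of_dictionary_of_eq _ rfl
    (exists_supplyWitness_of_faceSupply _ _ _ _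
      (faceSupply_of_thm418AsPrinted_pinnedE_isog _ _ _ _ D Aμ₀ AK homE hE hLiu hObj hChi hirr hsm hμ hCMisogE hComp)) hD

/-- **END DISPLAY, integral variant** (`hU : U = U_rec`): own-htheta's `Model.hc_cm_of_thm418AsPrinted_pinned` BY NAME at the
E-rational pin, with `hCM := Model.hCM_of_hCMμ_baseChange D Aμ₀ hCMμE` (pin-2 §4).  `hCMμE` is STRONGER THAN PRINT at objects of
`𝒜(μ)` whose lattice is not `𝓞_{M_μ}`-stable (module docstring); the display of record is `hc_cm_of_thm418AsPrinted_pinnedE_isog`.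
All other binders as there (`hReach :=` pin-1's `Model.pinReach_of_componentPinE`).  HC_CM is NOT proved: `hCMμE`, `hComp`, `hD` are not
inhabited here.
[cite: Liu2021, Thm. 4.18 (FJcycle.tex l. 2232–2245) and Def. 4.5 (2) (l. 1944–1951)] -/
theorem hc_cm_of_thm418AsPrinted_pinnedE (U : Universe)
    (hU : U = picardCMUniverse exists_isReal_hodgeModel_holds hodgePQ_independent_of_hodgeModel_holds
      BallQuotient.ballQuotientUniformised_holds cmAbelianVarietyRealised_holds)
    (D : ∀ (F : CMField) (ι₁ : F →+* ℂ) (_ : HermSpace3 F ι₁) (_ : CMType F), Thm418Data (maximalRealSubfield F) F)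
    (Aμ₀ : ∀ (F : CMField) (ι₁ : F →+* ℂ) (V : HermSpace3 F ι₁) (Φ : CMType F), (D F ι₁ V Φ).Obj → AbelianVariety F)
    (AK : ∀ (F : CMField) (ι₁ : F →+* ℂ) (V : HermSpace3 F ι₁) (Φ : CMType F), Subgroup (D F ι₁ V Φ).G → AbelianVariety F)
    (homE : ∀ (F : CMField) (ι₁ : F →+* ℂ) (V : HermSpace3 F ι₁) (Φ : CMType F) (K : Subgroup (D F ι₁ V Φ).G)
      (Dμ : (D F ι₁ V Φ).Obj), (D F ι₁ V Φ).HomK K Dμ →+ ℚ ⊗[ℤ] (AK F ι₁ V Φ K ⟶ Aμ₀ F ι₁ V Φ Dμ))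
    (hE : ∀ (F : CMField) (ι₁ : F →+* ℂ) (V : HermSpace3 F ι₁) (Φ : CMType F) (K : Subgroup (D F ι₁ V Φ).G)
      (Dμ : (D F ι₁ V Φ).Obj), Function.Injective (homE F ι₁ V Φ K Dμ))
    (hLiu : ∀ (F : CMField), IsGalois ℚ F → 6 ≤ Module.finrank ℚ F → ∀ (Φ : CMType F) (ι₁ : F →+* ℂ), ι₁ ∈ Φ.1 →
      ∀ V : HermSpace3 F ι₁, Thm418AsPrinted (D F ι₁ V Φ))
    (hObj : ∀ (F : CMField), IsGalois ℚ F → 6 ≤ Module.finrank ℚ F → ∀ (Φ : CMType F) (ι₁ : F →+* ℂ), ι₁ ∈ Φ.1 →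
      ∀ V : HermSpace3 F ι₁, Nonempty (D F ι₁ V Φ).Obj)
    (hChi : ∀ (F : CMField), IsGalois ℚ F → 6 ≤ Module.finrank ℚ F → ∀ (Φ : CMType F) (ι₁ : F →+* ℂ), ι₁ ∈ Φ.1 →
      ∀ V : HermSpace3 F ι₁, Nonempty (D F ι₁ V Φ).Chi)
    (hirr : ∀ (F : CMField), IsGalois ℚ F → 6 ≤ Module.finrank ℚ F → ∀ (Φ : CMType F) (ι₁ : F →+* ℂ), ι₁ ∈ Φ.1 →
      ∀ (V : HermSpace3 F ι₁) (i : (D F ι₁ V Φ).AdmIndex), ((D F ι₁ V Φ).rhoAt i).IsIrreducible)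
    (hsm : ∀ (F : CMField), IsGalois ℚ F → 6 ≤ Module.finrank ℚ F → ∀ (Φ : CMType F) (ι₁ : F →+* ℂ), ι₁ ∈ Φ.1 →
      ∀ (V : HermSpace3 F ι₁) (i : (D F ι₁ V Φ).AdmIndex) (v : (D F ι₁ V Φ).omegaAt i),
        ∃ S : Subgroup (D F ι₁ V Φ).G, IsOpen (S : Set (D F ι₁ V Φ).G) ∧ ∀ k ∈ S, (D F ι₁ V Φ).rhoAt i k v = v)
    (hμ : ∀ (F : CMField), IsGalois ℚ F → 6 ≤ Module.finrank ℚ F → ∀ (Φ : CMType F) (ι₁ : F →+* ℂ), ι₁ ∈ Φ.1 →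
      ∀ (V : HermSpace3 F ι₁) (g : F ≃ₐ[ℚ] F),
        ι₁.comp (g : F →+* F) ∈ (D F ι₁ V Φ).cmType.1 ↔ ι₁.comp (g.symm : F →+* F) ∈ Φ.1)
    (hCMμE : ∀ (F : CMField) [IsGalois ℚ F], 6 ≤ Module.finrank ℚ F → ∀ (Φ : CMType F) (ι₁ : F →+* ℂ), ι₁ ∈ Φ.1 →
      ∀ (V : HermSpace3 F ι₁) (Dμ : (D F ι₁ V Φ).Obj),
        haveI := (D F ι₁ V Φ).isConjugateSymplectic.numberField_muAlgValueField
        ∀ e : reflexField ℚ F (algValuedIn ι₁ (D F ι₁ V Φ).cmType.1) →+* muAlgValueField F (D F ι₁ V Φ).μ,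
          (∀ k : reflexField ℚ F (algValuedIn ι₁ (D F ι₁ V Φ).cmType.1),
            ((e k : muAlgValueField F (D F ι₁ V Φ).μ) : ℂ) = ι₁ k) →
          ∃ (ιB : 𝓞 (muAlgValueField F (D F ι₁ V Φ).μ) →+*
                End (letI := ι₁.toAlgebra; (Aμ₀ F ι₁ V Φ Dμ).baseChange ℂ))
            (θB : muAlgValueField F (D F ι₁ V Φ).μ →+*
                Module.End ℂ (complexBetti (letI := ι₁.toAlgebra; (Aμ₀ F ι₁ V Φ Dμ).baseChange ℂ).X 1)),
            IsCMTypeRealisation (inducedCMType e (reflexCMType ι₁ (D F ι₁ V Φ).cmType (AlgHom.id ℚ F)))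
              (letI := ι₁.toAlgebra; (Aμ₀ F ι₁ V Φ Dμ).baseChange ℂ) ιB θB)
    (hComp : ∀ (F : CMField), IsGalois ℚ F → 6 ≤ Module.finrank ℚ F → ∀ (Φ : CMType F) (ι₁ : F →+* ℂ), ι₁ ∈ Φ.1 →
      ∀ V : HermSpace3 F ι₁, ∃ Ksm : Subgroup (D F ι₁ V Φ).G, IsOpenCompact Ksm ∧
        ∀ K : Subgroup (D F ι₁ V Φ).G, IsOpenCompact K → K ≤ Ksm →
          ∃ (C : Type) (_ : Fintype C) (X : C → SchemeOver ℂ) (B : ∀ c, UnitaryBallUniformisationDatum 2 (X c))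
            (Γ : C → Level V) (𝒥 : ∀ c, Jacobian (X c))
            (π : ∀ c, (letI := ι₁.toAlgebra; (AK F ι₁ V Φ K).baseChange ℂ) ⟶ (𝒥 c).J),
            (∀ c, (B c).Hℂ = V.Hm.map ι₁) ∧
            (∀ c, (B c).Γ.map (Matrix.GeneralLinearGroup.map (B c).τ₁) =
              (Γ c).Γ.map (Matrix.GeneralLinearGroup.map ι₁)) ∧
            Nonempty (IsLimit (Fan.mk (letI := ι₁.toAlgebra; (AK F ι₁ V Φ K).baseChange ℂ) π)))
    (hD : ∀ (F : CMField), IsGalois ℚ F → 6 ≤ Module.finrank ℚ F → ∀ (f : Face F) (ι₁ : F →+* ℂ), f.Admissible ι₁ →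
      ∀ V : HermSpace3 F ι₁,
        ∃ (HG : Type) (_ : NormedAddCommGroup HG) (_ : InnerProductSpace ℂ HG)
          (emb : ∀ Γ : Level V, U.CohC (U.pms F ι₁ V Γ) 2 →ₗ[ℂ] HG)
          (cover : ∀ (Γ Γ' : Level V), Γ' ≤ Γ → U.Mor (U.pms F ι₁ V Γ') (U.pms F ι₁ V Γ)),
          (∀ (Γ : Level V) (ω₁ ω₂ : U.CohC (U.pms F ι₁ V Γ) 1), ω₁ ∈ U.Uiso Γ F (f.psi 0) ι₁ → ω₂ ∈ U.Uiso Γ F (f.psi 1) ι₁ →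
            emb Γ (U.cup2C (U.pms F ι₁ V Γ) 1 ω₁ ω₂) ∈ (Submodule.span ℂ
              {x : HG | ∃ (Γ' : Level V), ∃ ω₃ ∈ U.Uiso Γ' F (f.psi 2) ι₁, ∃ ω₄ ∈ U.Uiso Γ' F (f.psi 3) ι₁,
                x = emb Γ' (U.cup2C (U.pms F ι₁ V Γ') 1 ω₃ ω₄)}).topologicalClosure) ∧
          (∀ (Γ Γ' : Level V) (hle : Γ' ≤ Γ) (x : U.CohC (U.pms F ι₁ V Γ) 2),
            emb Γ' (U.pullC (cover Γ Γ' hle) 2 x) = emb Γ x) ∧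
          (∀ Γ : Level V, ∃ c : ℂ, c ≠ 0 ∧ ∀ x y : U.CohC (U.pms F ι₁ V Γ) 2,
            x ∈ (U.hodge (U.pms F ι₁ V Γ) 2).F 2 → y ∈ (U.hodge (U.pms F ι₁ V Γ) 2).F 2 →
              ⟪emb Γ y, emb Γ x⟫_ℂ = c * U.trC (U.pms F ι₁ V Γ) 4 (U.cup2C (U.pms F ι₁ V Γ) 2 x (conj y)))) :
    HC_CM :=
  hc_cm_of_thm418AsPrinted_pinned U hU D (fun F ι₁ V Φ Dμ => letI := ι₁.toAlgebra; (Aμ₀ F ι₁ V Φ Dμ).baseChange ℂ)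
    hLiu hObj hChi hirr hsm hμ (hCM_of_hCMμ_baseChange D Aμ₀ hCMμE)
    (pinReach_of_componentPinE BallQuotient.ballQuotientUniformised_holds cmAbelianVarietyRealised_holds D AK Aμ₀ homE hE
      hComp) hD

end EndState

end Summit.HodgeConjecture.CorCM.Model

end
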